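import Mathlib.Analysis.Calculus.Taylor
import Literature.NumberTheory.Sieve.LargeSieveLargeConductors
import HarnessLib

/-!
# Route `PrimeLevelFamEdge`, crux K_B (stmt-Parity-20343), line `diagonal_kernel_split` rev 4, plan Ω,
# node **L7c — separation of the level variable `q` from a smooth weight** (OMEGA-BLUEPRINT v4 §3c)

The large-sieve half of Barban–Davenport–Halberstam
(`Literature.NumberTheory.Sieve.LargeSieve.sum_totient_inv_largeConductor_le`, E18) needs ONE sequence `a_q`
for all moduli `h ≤ Q` and all characters.  On the dual side of the off-diagonal the level `q ∈ (N, 2N]` enters a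
smooth weight `F_θ(q)` (`θ` = the outer parameters: layer, box, dual frequency, class), so before E18 can be applied
the `q`-dependence must be SEPARATED from `θ`: `F_θ(q) = Σ_{j<J} c_j(θ)·u_j(q) + E_θ(q)` with UNIVERSAL bounded
sequences `u_j` (the same for every `θ`), coefficients `c_j(θ)` with a geometric majorant and a small remainder.
This file is that device, generic and explicit:

* `taylorWithinEval_eq_sum_rescaled` — the Taylor polynomial in the rescaled monomials `((t−t₀)/ℓ)^j` with
  coefficients `c_j = (ℓ^j/j!)·G^{(j)}(t₀)`;
* **`norm_sub_taylor_sum_le`** — for `G ∈ C^J[t₀, t₀+ℓ]` with `‖G^{(J)}‖ ≤ M`: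
  `‖G(t) − Σ_{j<J} c_j ((t−t₀)/ℓ)^j‖ ≤ M ℓ^J/(J−1)!` (Mathlib's `taylor_mean_remainder_bound`);
* `abs_rescaled_pow_le_one` — the universal sequences are bounded by `1` on the interval;
* `norm_taylorCoeff_le` / `norm_sub_taylor_sum_le_of_factorial_bound` — under the analytic-type bound
  `‖G^{(j)}‖ ≤ A·j!/ρ^j` and `ℓ ≤ ρ/2`: `‖c_j‖ ≤ A·2^{−j}` and remainder `≤ A·J·2^{−J}` (so `J ≍ log N` terms suffice,
  on blocks of relative length `1/(2B)` when each `q∂_q` costs `B`);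
* **`norm_sum_mul_sub_separated_le`** — the separation UNDER A FINITE SUM against arbitrary complex weights `b_i` at
  sample points `t_i ∈ [t₀, t₀+ℓ]` (e.g. `t_q = q` or `t_q = N/q` for the levels `q` of one block):
  `‖Σ_i b_i G(t_i) − Σ_{j<J} c_j Σ_i b_i ((t_i−t₀)/ℓ)^j‖ ≤ (M ℓ^J/(J−1)!)·Σ_i ‖b_i‖`;
* `…_of_isOpen` variants — the same with plain `iteratedDeriv` when `G ∈ C^J(U)`, `U ⊇ [t₀,t₀+ℓ]` open;
* `norm_sum_mul_sq_le_weighted` — `‖Σ_k c_k v_k‖² ≤ (Σ_k ‖c_k‖)·Σ_k ‖c_k‖‖v_k‖²` (the Cauchy–Schwarz that carries a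
  separated weight through a mean square without a `#terms` loss);
* **`sum_totient_inv_largeConductor_separated_le`** — E18 WITH A SEPARATED WEIGHT depending on the modulus and the
  character: `Σ_{h≤Q} φ(h)⁻¹ Σ_{cond χ>R} |Σ_n a_n (Σ_k c_k(h,χ) u_k(n)) χ(n)|² ≤ (Σ_k γ_k)²(1+log Q)²(2(N+1)/R+4Q)Σ|a_n|²`
  when `‖c_k(h,χ)‖ ≤ γ_k`, `‖u_k(n)‖ ≤ 1`;
* `sum_range_sum_Ioc_eq` / `sum_Ioc_eq_sum_blocks` / `block_length_le` — bookkeeping for cutting the level block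
  `(M₀, M₀+N]` into `T` consecutive sub-blocks `(M₀ + ⌊iN/T⌋, M₀ + ⌊(i+1)N/T⌋]` of length `≤ ⌊N/T⌋ + 1` (E18 is then
  applied per sub-block with its own `M₀`, so the `N/R`-term adds up to `N/R` and only the `4Q`-term is multiplied by `T`).

Pure real/complex analysis and finite sums; nothing about primes, characters beyond E18 as imported, or the off-diagonal
objects (the instantiation on `OffDiag.boxWeight`'s `q`-dependence is the consumer's, L7d). Helper; closes nothing;
standard axioms. «The programme SEARCHES and TYPES; no claim about Landau–Siegel zeros, Theorems 1–2 of
arXiv:2211.02515 or a repaired Margin232 until a kernel theorem says so.»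
-/

noncomputable section

open Finset Real
open scoped Nat

namespace Summit.Parity.GeneralizedHardyLittlewood.Theorems.BeyondDiagonalBeatsQuarter.LevelSeparation

open Literature.NumberTheory.Sieve (primIndex induce)
open Literature.NumberTheory.Sieve.LargeSieve (sum_totient_inv_largeConductor_le)

/-! ### Taylor separation on one interval -/

/-- The Taylor polynomial of `G` at `t₀` of order `n`, rewritten in the rescaled monomials `((t − t₀)/ℓ)^j`
(`ℓ ≠ 0`): `Σ_{j ≤ n} [(ℓ^j/j!)·G^{(j)}(t₀)] · ((t−t₀)/ℓ)^j`. [folklore] -/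
theorem taylorWithinEval_eq_sum_rescaled (G : ℝ → ℂ) (n : ℕ) (s : Set ℝ) (t₀ ℓ t : ℝ) (hℓ : ℓ ≠ 0) :
    taylorWithinEval G n s t₀ t =
      ∑ j ∈ Finset.range (n + 1),
        (((ℓ ^ j / j ! : ℝ) : ℂ) * iteratedDerivWithin j G s t₀) * ((((t - t₀) / ℓ) ^ j : ℝ) : ℂ) := by
  rw [taylor_within_apply]
  refine Finset.sum_congr rfl fun j _ => ?_
  rw [Complex.real_smul]
  have hj : (j ! : ℝ) ≠ 0 := by positivity
  have h1 : ((j ! : ℝ)⁻¹ * (t - t₀) ^ j : ℝ) = (ℓ ^ j / j !) * (((t - t₀) / ℓ) ^ j) := by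
    rw [div_pow]
    field_simp
  rw [h1]
  push_cast
  ring

/-- The universal sequences are bounded by one: `|((t − t₀)/ℓ)^j| ≤ 1` for `t ∈ [t₀, t₀ + ℓ]`, `ℓ > 0`.
[folklore] -/
theorem abs_rescaled_pow_le_one {t₀ ℓ t : ℝ} (hℓ : 0 < ℓ) (ht : t ∈ Set.Icc t₀ (t₀ + ℓ)) (j : ℕ) :
    |((t - t₀) / ℓ) ^ j| ≤ 1 := by
  rw [abs_pow]
  refine pow_le_one₀ (abs_nonneg _) ?_
  rw [abs_div, abs_of_pos hℓ, div_le_one hℓ, abs_le]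
  constructor <;> linarith [ht.1, ht.2]

/-- Complex-norm form of `abs_rescaled_pow_le_one`. [folklore] -/
theorem norm_rescaled_pow_le_one {t₀ ℓ t : ℝ} (hℓ : 0 < ℓ) (ht : t ∈ Set.Icc t₀ (t₀ + ℓ)) (j : ℕ) :
    ‖((((t - t₀) / ℓ) ^ j : ℝ) : ℂ)‖ ≤ 1 := by
  rw [Complex.norm_real, Real.norm_eq_abs]
  exact abs_rescaled_pow_le_one hℓ ht j

/-- **Taylor separation with an explicit remainder.** If `G ∈ C^J[t₀, t₀ + ℓ]` (`J ≥ 1`, `ℓ > 0`) and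
`‖G^{(J)}‖ ≤ M` on the interval, then for `t ∈ [t₀, t₀ + ℓ]`
`‖G(t) − Σ_{j<J} [(ℓ^j/j!) G^{(j)}(t₀)]·((t−t₀)/ℓ)^j‖ ≤ M·ℓ^J/(J−1)!`
(derivatives are `iteratedDerivWithin _ G (Icc t₀ (t₀+ℓ))`). [folklore] -/
theorem norm_sub_taylor_sum_le {G : ℝ → ℂ} {t₀ ℓ M : ℝ} {J : ℕ} (hℓ : 0 < ℓ) (hJ : 1 ≤ J)
    (hG : ContDiffOn ℝ J G (Set.Icc t₀ (t₀ + ℓ)))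
    (hM : ∀ y ∈ Set.Icc t₀ (t₀ + ℓ), ‖iteratedDerivWithin J G (Set.Icc t₀ (t₀ + ℓ)) y‖ ≤ M)
    {t : ℝ} (ht : t ∈ Set.Icc t₀ (t₀ + ℓ)) :
    ‖G t - ∑ j ∈ Finset.range J,
        (((ℓ ^ j / j ! : ℝ) : ℂ) * iteratedDerivWithin j G (Set.Icc t₀ (t₀ + ℓ)) t₀) *
          ((((t - t₀) / ℓ) ^ j : ℝ) : ℂ)‖ ≤ M * ℓ ^ J / (J - 1)! := by
  obtain ⟨n, rfl⟩ : ∃ n, J = n + 1 := ⟨J - 1, by omega⟩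
  have hM0 : 0 ≤ M := (norm_nonneg _).trans (hM t₀ (Set.left_mem_Icc.2 (by linarith)))
  have hG' : ContDiffOn ℝ (n + 1) G (Set.Icc t₀ (t₀ + ℓ)) := by exact_mod_cast hG
  have h := taylor_mean_remainder_bound (f := G) (a := t₀) (b := t₀ + ℓ) (C := M) (x := t) (n := n)
    (by linarith) hG' ht hM
  rw [taylorWithinEval_eq_sum_rescaled G n _ t₀ ℓ t hℓ.ne'] at h
  simp only [Nat.add_sub_cancel]
  refine h.trans ?_
  have h1 : (t - t₀) ^ (n + 1) ≤ ℓ ^ (n + 1) :=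
    pow_le_pow_left₀ (by linarith [ht.1]) (by linarith [ht.2]) _
  have h2 : (0 : ℝ) < n ! := by positivity
  rw [mul_div_assoc, mul_div_assoc]
  exact mul_le_mul_of_nonneg_left (div_le_div_of_nonneg_right h1 h2.le) hM0

/-- **Coefficient bound under an analytic-type derivative bound.** If `‖G^{(j)}(t₀)‖ ≤ A·j!/ρ^j` (`ρ > 0`,
`ℓ ≥ 0`) then the rescaled Taylor coefficient satisfies `‖(ℓ^j/j!)·G^{(j)}(t₀)‖ ≤ A·(ℓ/ρ)^j`. [folklore] -/
theorem norm_taylorCoeff_le {G : ℝ → ℂ} {s : Set ℝ} {t₀ ℓ A ρ : ℝ} {j : ℕ} (hℓ : 0 ≤ ℓ) (hρ : 0 < ρ)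
    (hD : ‖iteratedDerivWithin j G s t₀‖ ≤ A * j ! / ρ ^ j) :
    ‖((ℓ ^ j / j ! : ℝ) : ℂ) * iteratedDerivWithin j G s t₀‖ ≤ A * (ℓ / ρ) ^ j := by
  have hj : (0 : ℝ) < j ! := by positivity
  have hρj : (0 : ℝ) < ρ ^ j := pow_pos hρ j
  rw [norm_mul, Complex.norm_real, Real.norm_eq_abs, abs_of_nonneg (by positivity)]
  calc ℓ ^ j / j ! * ‖iteratedDerivWithin j G s t₀‖
      ≤ ℓ ^ j / j ! * (A * j ! / ρ ^ j) := mul_le_mul_of_nonneg_left hD (by positivity)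
    _ = A * (ℓ / ρ) ^ j := by rw [div_pow]; field_simp

/-- **Separation with geometric coefficients.** If `‖G^{(J)}(y)‖ ≤ A·J!/ρ^J` on `[t₀, t₀+ℓ]` and `ℓ ≤ ρ/2`, the
remainder of `norm_sub_taylor_sum_le` is `≤ A·J·2^{−J}`. (With `norm_taylorCoeff_le` the coefficients are
`≤ A·2^{−j}`.) [folklore] -/
theorem norm_sub_taylor_sum_le_of_factorial_bound {G : ℝ → ℂ} {t₀ ℓ A ρ : ℝ} {J : ℕ} (hℓ : 0 < ℓ)
    (hρ : 0 < ρ) (hℓρ : ℓ ≤ ρ / 2) (hJ : 1 ≤ J) (hG : ContDiffOn ℝ J G (Set.Icc t₀ (t₀ + ℓ)))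
    (hA : ∀ y ∈ Set.Icc t₀ (t₀ + ℓ), ‖iteratedDerivWithin J G (Set.Icc t₀ (t₀ + ℓ)) y‖ ≤ A * J ! / ρ ^ J)
    {t : ℝ} (ht : t ∈ Set.Icc t₀ (t₀ + ℓ)) :
    ‖G t - ∑ j ∈ Finset.range J,
        (((ℓ ^ j / j ! : ℝ) : ℂ) * iteratedDerivWithin j G (Set.Icc t₀ (t₀ + ℓ)) t₀) *
          ((((t - t₀) / ℓ) ^ j : ℝ) : ℂ)‖ ≤ A * J * (1 / 2) ^ J := by
  have h := norm_sub_taylor_sum_le hℓ hJ hG hA ht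
  refine h.trans ?_
  obtain ⟨n, rfl⟩ : ∃ n, J = n + 1 := ⟨J - 1, by omega⟩
  simp only [Nat.add_sub_cancel]
  have hA0 : 0 ≤ A := by
    have h0 := (norm_nonneg _).trans (hA t₀ (Set.left_mem_Icc.2 (by linarith)))
    have h1 : (0 : ℝ) < (n + 1)! / ρ ^ (n + 1) := by positivity
    have h2 : A * (n + 1)! / ρ ^ (n + 1) = A * ((n + 1)! / ρ ^ (n + 1)) := by ring
    rw [h2] at h0
    exact nonneg_of_mul_nonneg_left h0 h1
  have hn : (0 : ℝ) < n ! := by positivity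
  have hratio : ℓ / ρ ≤ 1 / 2 := by rw [div_le_iff₀ hρ]; linarith
  have hratio0 : 0 ≤ ℓ / ρ := div_nonneg hℓ.le hρ.le
  calc A * (n + 1)! / ρ ^ (n + 1) * ℓ ^ (n + 1) / n !
      = A * ((n + 1 : ℕ) : ℝ) * (ℓ / ρ) ^ (n + 1) := by
        rw [Nat.factorial_succ, Nat.cast_mul, div_pow]
        field_simp
    _ ≤ A * ((n + 1 : ℕ) : ℝ) * (1 / 2) ^ (n + 1) := by
        refine mul_le_mul_of_nonneg_left (pow_le_pow_left₀ hratio0 hratio _) (by positivity)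
    _ = A * ↑(n + 1) * (1 / 2) ^ (n + 1) := by norm_cast

/-! ### Separation under a finite sum (the level block against arbitrary weights) -/

/-- **Separation under a finite sum.** For `G ∈ C^J[t₀,t₀+ℓ]` with `‖G^{(J)}‖ ≤ M`, sample points
`t_i ∈ [t₀, t₀+ℓ]` and complex weights `b_i` (`i ∈ S` finite):
`‖Σ_i b_i G(t_i) − Σ_{j<J} c_j · Σ_i b_i ((t_i−t₀)/ℓ)^j‖ ≤ (M ℓ^J/(J−1)!)·Σ_i ‖b_i‖`, `c_j = (ℓ^j/j!) G^{(j)}(t₀)`: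
the weight is replaced by `J` universal sequences at the cost of a uniform remainder. [folklore] -/
theorem norm_sum_mul_sub_separated_le {ι : Type*} (S : Finset ι) (b : ι → ℂ) (t : ι → ℝ)
    {G : ℝ → ℂ} {t₀ ℓ M : ℝ} {J : ℕ} (hℓ : 0 < ℓ) (hJ : 1 ≤ J)
    (hG : ContDiffOn ℝ J G (Set.Icc t₀ (t₀ + ℓ)))
    (hM : ∀ y ∈ Set.Icc t₀ (t₀ + ℓ), ‖iteratedDerivWithin J G (Set.Icc t₀ (t₀ + ℓ)) y‖ ≤ M)
    (ht : ∀ i ∈ S, t i ∈ Set.Icc t₀ (t₀ + ℓ)) :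
    ‖∑ i ∈ S, b i * G (t i) -
        ∑ j ∈ Finset.range J,
          (((ℓ ^ j / j ! : ℝ) : ℂ) * iteratedDerivWithin j G (Set.Icc t₀ (t₀ + ℓ)) t₀) *
            ∑ i ∈ S, b i * ((((t i - t₀) / ℓ) ^ j : ℝ) : ℂ)‖ ≤
      M * ℓ ^ J / (J - 1)! * ∑ i ∈ S, ‖b i‖ := by
  set c : ℕ → ℂ := fun j => ((ℓ ^ j / j ! : ℝ) : ℂ) * iteratedDerivWithin j G (Set.Icc t₀ (t₀ + ℓ)) t₀ with hc
  have hswap : ∑ j ∈ Finset.range J, c j * ∑ i ∈ S, b i * ((((t i - t₀) / ℓ) ^ j : ℝ) : ℂ) =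
      ∑ i ∈ S, b i * ∑ j ∈ Finset.range J, c j * ((((t i - t₀) / ℓ) ^ j : ℝ) : ℂ) := by
    simp_rw [Finset.mul_sum]
    rw [Finset.sum_comm]
    exact Finset.sum_congr rfl fun i _ => Finset.sum_congr rfl fun j _ => by ring
  rw [hswap, ← Finset.sum_sub_distrib, Finset.mul_sum]
  refine (norm_sum_le _ _).trans (Finset.sum_le_sum fun i hi => ?_)
  rw [← mul_sub, norm_mul, mul_comm]
  exact mul_le_mul_of_nonneg_right (norm_sub_taylor_sum_le hℓ hJ hG hM (ht i hi)) (norm_nonneg _)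

/-! ### Open-neighbourhood forms (plain `iteratedDeriv`) -/

/-- On `[t₀, t₀+ℓ] ⊆ U` open with `G ∈ C^J(U)`, the one-sided derivatives are the plain ones:
`iteratedDerivWithin j G [t₀,t₀+ℓ] = iteratedDeriv j G` on the interval, `j ≤ J`. [folklore] -/
theorem iteratedDerivWithin_Icc_eq_iteratedDeriv {G : ℝ → ℂ} {U : Set ℝ} {t₀ ℓ : ℝ} {J j : ℕ} (hℓ : 0 < ℓ)
    (hU : IsOpen U) (hsub : Set.Icc t₀ (t₀ + ℓ) ⊆ U) (hG : ContDiffOn ℝ J G U) (hj : j ≤ J) {y : ℝ}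
    (hy : y ∈ Set.Icc t₀ (t₀ + ℓ)) :
    iteratedDerivWithin j G (Set.Icc t₀ (t₀ + ℓ)) y = iteratedDeriv j G y := by
  have hGy : ContDiffAt ℝ (J : ℕ∞) G y := hG.contDiffAt (hU.mem_nhds (hsub hy))
  exact iteratedDerivWithin_eq_iteratedDeriv (uniqueDiffOn_Icc (by linarith))
    (hGy.of_le (by exact_mod_cast hj)) hy

/-- **Taylor separation, open-neighbourhood form**: `G ∈ C^J(U)` for an open `U ⊇ [t₀, t₀+ℓ]` and
`‖iteratedDeriv J G‖ ≤ M` on the interval give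
`‖G(t) − Σ_{j<J} [(ℓ^j/j!)·iteratedDeriv j G t₀]·((t−t₀)/ℓ)^j‖ ≤ M ℓ^J/(J−1)!`. [folklore] -/
theorem norm_sub_taylor_sum_le_of_isOpen {G : ℝ → ℂ} {U : Set ℝ} {t₀ ℓ M : ℝ} {J : ℕ} (hℓ : 0 < ℓ)
    (hJ : 1 ≤ J) (hU : IsOpen U) (hsub : Set.Icc t₀ (t₀ + ℓ) ⊆ U) (hG : ContDiffOn ℝ J G U)
    (hM : ∀ y ∈ Set.Icc t₀ (t₀ + ℓ), ‖iteratedDeriv J G y‖ ≤ M)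
    {t : ℝ} (ht : t ∈ Set.Icc t₀ (t₀ + ℓ)) :
    ‖G t - ∑ j ∈ Finset.range J,
        (((ℓ ^ j / j ! : ℝ) : ℂ) * iteratedDeriv j G t₀) * ((((t - t₀) / ℓ) ^ j : ℝ) : ℂ)‖ ≤
      M * ℓ ^ J / (J - 1)! := by
  have ht₀ : t₀ ∈ Set.Icc t₀ (t₀ + ℓ) := Set.left_mem_Icc.2 (by linarith)
  have h := norm_sub_taylor_sum_le hℓ hJ (hG.mono hsub) (fun y hy => by
    rw [iteratedDerivWithin_Icc_eq_iteratedDeriv hℓ hU hsub hG le_rfl hy]; exact hM y hy) ht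
  have hsum : ∑ j ∈ Finset.range J,
      (((ℓ ^ j / j ! : ℝ) : ℂ) * iteratedDerivWithin j G (Set.Icc t₀ (t₀ + ℓ)) t₀) *
        ((((t - t₀) / ℓ) ^ j : ℝ) : ℂ) =
      ∑ j ∈ Finset.range J, (((ℓ ^ j / j ! : ℝ) : ℂ) * iteratedDeriv j G t₀) *
        ((((t - t₀) / ℓ) ^ j : ℝ) : ℂ) :=
    Finset.sum_congr rfl fun j hj => by
      rw [iteratedDerivWithin_Icc_eq_iteratedDeriv hℓ hU hsub hG (Finset.mem_range.1 hj).le ht₀]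
  rwa [hsum] at h

/-- **Separation under a finite sum, open-neighbourhood form** (plain `iteratedDeriv` coefficients).
[folklore] -/
theorem norm_sum_mul_sub_separated_le_of_isOpen {ι : Type*} (S : Finset ι) (b : ι → ℂ) (t : ι → ℝ)
    {G : ℝ → ℂ} {U : Set ℝ} {t₀ ℓ M : ℝ} {J : ℕ} (hℓ : 0 < ℓ) (hJ : 1 ≤ J) (hU : IsOpen U)
    (hsub : Set.Icc t₀ (t₀ + ℓ) ⊆ U) (hG : ContDiffOn ℝ J G U)
    (hM : ∀ y ∈ Set.Icc t₀ (t₀ + ℓ), ‖iteratedDeriv J G y‖ ≤ M)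
    (ht : ∀ i ∈ S, t i ∈ Set.Icc t₀ (t₀ + ℓ)) :
    ‖∑ i ∈ S, b i * G (t i) -
        ∑ j ∈ Finset.range J, (((ℓ ^ j / j ! : ℝ) : ℂ) * iteratedDeriv j G t₀) *
            ∑ i ∈ S, b i * ((((t i - t₀) / ℓ) ^ j : ℝ) : ℂ)‖ ≤
      M * ℓ ^ J / (J - 1)! * ∑ i ∈ S, ‖b i‖ := by
  set c : ℕ → ℂ := fun j => ((ℓ ^ j / j ! : ℝ) : ℂ) * iteratedDeriv j G t₀ with hc
  have hswap : ∑ j ∈ Finset.range J, c j * ∑ i ∈ S, b i * ((((t i - t₀) / ℓ) ^ j : ℝ) : ℂ) =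
      ∑ i ∈ S, b i * ∑ j ∈ Finset.range J, c j * ((((t i - t₀) / ℓ) ^ j : ℝ) : ℂ) := by
    simp_rw [Finset.mul_sum]
    rw [Finset.sum_comm]
    exact Finset.sum_congr rfl fun i _ => Finset.sum_congr rfl fun j _ => by ring
  rw [hswap, ← Finset.sum_sub_distrib, Finset.mul_sum]
  refine (norm_sum_le _ _).trans (Finset.sum_le_sum fun i hi => ?_)
  rw [← mul_sub, norm_mul, mul_comm]
  exact mul_le_mul_of_nonneg_right
    (norm_sub_taylor_sum_le_of_isOpen hℓ hJ hU hsub hG hM (ht i hi)) (norm_nonneg _)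

/-! ### Carrying a separated weight through a mean square -/

/-- **Weighted Cauchy–Schwarz**: `‖Σ_k c_k v_k‖² ≤ (Σ_k ‖c_k‖)·Σ_k ‖c_k‖·‖v_k‖²` — a separated weight with
`ℓ¹`-summable coefficients passes through a mean square at the cost `(Σ‖c_k‖)²`, with no loss in the number of
terms. [folklore] -/
theorem norm_sum_mul_sq_le_weighted {κ : Type*} (K : Finset κ) (c v : κ → ℂ) :
    ‖∑ k ∈ K, c k * v k‖ ^ 2 ≤ (∑ k ∈ K, ‖c k‖) * ∑ k ∈ K, ‖c k‖ * ‖v k‖ ^ 2 := by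
  have h1 : ‖∑ k ∈ K, c k * v k‖ ≤ ∑ k ∈ K, ‖c k‖ * ‖v k‖ :=
    (norm_sum_le _ _).trans (le_of_eq (Finset.sum_congr rfl fun k _ => norm_mul _ _))
  have h2 : (∑ k ∈ K, ‖c k‖ * ‖v k‖) ^ 2 ≤ (∑ k ∈ K, ‖c k‖) * ∑ k ∈ K, ‖c k‖ * ‖v k‖ ^ 2 :=
    Finset.sum_sq_le_sum_mul_sum_of_sq_le_mul K (fun k _ => norm_nonneg _)
      (fun k _ => mul_nonneg (norm_nonneg _) (sq_nonneg _)) (fun k _ => by ring_nf; rfl)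
  exact (pow_le_pow_left₀ (norm_nonneg _) h1 2).trans h2

open scoped Classical in
/-- **E18 with a separated weight.** For complex `a_n` on `(M₀, M₀+N]` with support coprime to every modulus
`h ≤ Q`, `1 ≤ R`, universal sequences `u_k` with `‖u_k(n)‖ ≤ 1` on the range, and coefficients `c_k(h,σ)` (depending
on the modulus `h` and the character index `σ`) with `‖c_k(h,σ)‖ ≤ γ_k`, `γ_k ≥ 0`:
`Σ_{h≤Q} φ(h)⁻¹ Σ_{σ ∈ S(h), cond > R} |Σ_n a_n·(Σ_k c_k(h,σ) u_k(n))·ψ_h(n)|²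
   ≤ (Σ_k γ_k)²·(1+log Q)²·(2(N+1)/R + 4Q)·Σ_n |a_n|²`
(`norm_sum_mul_sq_le_weighted`, then `sum_totient_inv_largeConductor_le` for each sequence `a_n u_k(n)`).
[cite: Davenport1980, ch. 29 — derivation; IwaniecKowalski2004, Thm 7.13 — derivation] -/
theorem sum_totient_inv_largeConductor_separated_le (a : ℕ → ℂ) (M₀ N R Q : ℕ) (hR : 1 ≤ R)
    (hcop : ∀ n ∈ Ioc M₀ (M₀ + N), a n ≠ 0 → ∀ h ∈ Icc 1 Q, n.Coprime h)
    {κ : Type*} (K : Finset κ) (u : κ → ℕ → ℂ) (hu : ∀ k ∈ K, ∀ n ∈ Ioc M₀ (M₀ + N), ‖u k n‖ ≤ 1)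
    (c : ℕ → (Σ d : ℕ, DirichletCharacter ℂ d) → κ → ℂ) (γ : κ → ℝ) (hγ : ∀ k ∈ K, 0 ≤ γ k)
    (hc : ∀ h ∈ Icc 1 Q, ∀ σ ∈ primIndex h, ∀ k ∈ K, ‖c h σ k‖ ≤ γ k) :
    ∑ h ∈ Icc 1 Q, ((h.totient : ℝ))⁻¹ *
        ∑ σ ∈ (primIndex h).filter (fun σ => R < σ.1),
          ‖∑ n ∈ Ioc M₀ (M₀ + N), a n * (∑ k ∈ K, c h σ k * u k n) * induce h σ n‖ ^ 2 ≤
      (∑ k ∈ K, γ k) ^ 2 * ((1 + Real.log Q) ^ 2 * (2 * ((N : ℝ) + 1) / R + 4 * Q)) *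
        ∑ n ∈ Ioc M₀ (M₀ + N), ‖a n‖ ^ 2 := by
  -- notation
  set I := Ioc M₀ (M₀ + N) with hI
  set LS : ℝ := (1 + Real.log Q) ^ 2 * (2 * ((N : ℝ) + 1) / R + 4 * Q) with hLS
  set Γ : ℝ := ∑ k ∈ K, γ k with hΓ
  have hΓ0 : 0 ≤ Γ := Finset.sum_nonneg hγ
  have hLS0 : 0 ≤ LS := by
    have hlog : 0 ≤ 1 + Real.log Q := by have := Real.log_natCast_nonneg Q; linarith
    have hR0 : (0 : ℝ) < R := by exact_mod_cast hR
    positivity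
  -- `V k h σ = Σ_n (a n u k n) ψ(n)`
  set V : κ → ℕ → (Σ d : ℕ, DirichletCharacter ℂ d) → ℂ :=
    fun k h σ => ∑ n ∈ I, (a n * u k n) * induce h σ n with hV
  -- pointwise: the inner sum is `Σ_k c_k V_k`, and weighted Cauchy–Schwarz
  have hpt : ∀ h ∈ Icc 1 Q, ∀ σ ∈ primIndex h,
      ‖∑ n ∈ I, a n * (∑ k ∈ K, c h σ k * u k n) * induce h σ n‖ ^ 2 ≤
        Γ * ∑ k ∈ K, γ k * ‖V k h σ‖ ^ 2 := by
    intro h hh σ hσ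
    have hexp : ∑ n ∈ I, a n * (∑ k ∈ K, c h σ k * u k n) * induce h σ n =
        ∑ k ∈ K, c h σ k * V k h σ := by
      simp only [hV, Finset.mul_sum, Finset.sum_mul]
      rw [Finset.sum_comm]
      exact Finset.sum_congr rfl fun k _ => Finset.sum_congr rfl fun n _ => by ring
    rw [hexp]
    refine (norm_sum_mul_sq_le_weighted K (c h σ) (fun k => V k h σ)).trans ?_
    have hck : ∑ k ∈ K, ‖c h σ k‖ ≤ Γ := Finset.sum_le_sum fun k hk => hc h hh σ hσ k hk
    have hin : ∑ k ∈ K, ‖c h σ k‖ * ‖V k h σ‖ ^ 2 ≤ ∑ k ∈ K, γ k * ‖V k h σ‖ ^ 2 :=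
      Finset.sum_le_sum fun k hk => mul_le_mul_of_nonneg_right (hc h hh σ hσ k hk) (sq_nonneg _)
    exact mul_le_mul hck hin (Finset.sum_nonneg fun k _ => mul_nonneg (norm_nonneg _) (sq_nonneg _)) hΓ0
  -- E18 for each `k`
  have hE18 : ∀ k ∈ K,
      ∑ h ∈ Icc 1 Q, ((h.totient : ℝ))⁻¹ *
          ∑ σ ∈ (primIndex h).filter (fun σ => R < σ.1), ‖V k h σ‖ ^ 2 ≤ LS * ∑ n ∈ I, ‖a n‖ ^ 2 := by
    intro k hk
    have hcop' : ∀ n ∈ Ioc M₀ (M₀ + N), a n * u k n ≠ 0 → ∀ h ∈ Icc 1 Q, n.Coprime h :=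
      fun n hn hne => hcop n hn (left_ne_zero_of_mul hne)
    have h1 := sum_totient_inv_largeConductor_le (fun n => a n * u k n) M₀ N R Q hR hcop'
    refine h1.trans (mul_le_mul_of_nonneg_left (Finset.sum_le_sum fun n hn => ?_) hLS0)
    rw [norm_mul]
    calc (‖a n‖ * ‖u k n‖) ^ 2 = ‖a n‖ ^ 2 * ‖u k n‖ ^ 2 := by ring
      _ ≤ ‖a n‖ ^ 2 * 1 := mul_le_mul_of_nonneg_left
          (pow_le_one₀ (norm_nonneg _) (hu k hk n hn)) (sq_nonneg _)
      _ = ‖a n‖ ^ 2 := mul_one _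
  -- assemble
  calc ∑ h ∈ Icc 1 Q, ((h.totient : ℝ))⁻¹ *
          ∑ σ ∈ (primIndex h).filter (fun σ => R < σ.1),
            ‖∑ n ∈ I, a n * (∑ k ∈ K, c h σ k * u k n) * induce h σ n‖ ^ 2
      ≤ ∑ h ∈ Icc 1 Q, ((h.totient : ℝ))⁻¹ *
          ∑ σ ∈ (primIndex h).filter (fun σ => R < σ.1), Γ * ∑ k ∈ K, γ k * ‖V k h σ‖ ^ 2 := by
        refine Finset.sum_le_sum fun h hh => mul_le_mul_of_nonneg_left
          (Finset.sum_le_sum fun σ hσ => hpt h hh σ (Finset.mem_filter.1 hσ).1) ?_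
        exact inv_nonneg.2 (Nat.cast_nonneg _)
    _ = Γ * ∑ k ∈ K, γ k * ∑ h ∈ Icc 1 Q, ((h.totient : ℝ))⁻¹ *
          ∑ σ ∈ (primIndex h).filter (fun σ => R < σ.1), ‖V k h σ‖ ^ 2 := by
        simp only [Finset.mul_sum]
        rw [Finset.sum_comm]
        refine Finset.sum_congr rfl fun h _ => ?_
        rw [Finset.sum_comm]
        exact Finset.sum_congr rfl fun σ _ => Finset.sum_congr rfl fun k _ => by ring
    _ ≤ Γ * ∑ k ∈ K, γ k * (LS * ∑ n ∈ I, ‖a n‖ ^ 2) := by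
        refine mul_le_mul_of_nonneg_left (Finset.sum_le_sum fun k hk => ?_) hΓ0
        exact mul_le_mul_of_nonneg_left (hE18 k hk) (hγ k hk)
    _ = Γ ^ 2 * LS * ∑ n ∈ I, ‖a n‖ ^ 2 := by rw [← Finset.sum_mul]; ring

/-! ### Cutting the level block into consecutive sub-blocks -/

/-- Consecutive blocks telescope: for monotone breakpoints `e`,
`Σ_{i<T} Σ_{n ∈ (e i, e (i+1)]} f n = Σ_{n ∈ (e 0, e T]} f n`. [folklore] -/
theorem sum_range_sum_Ioc_eq {M : Type*} [AddCommMonoid M] (f : ℕ → M) (e : ℕ → ℕ) (he : Monotone e)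
    (T : ℕ) : ∑ i ∈ Finset.range T, ∑ n ∈ Ioc (e i) (e (i + 1)), f n = ∑ n ∈ Ioc (e 0) (e T), f n := by
  induction T with
  | zero => simp
  | succ T ih =>
    rw [Finset.sum_range_succ, ih]
    exact Finset.sum_Ioc_consecutive f (he (Nat.zero_le T)) (he (Nat.le_succ T))

/-- The breakpoints `e i = M₀ + ⌊i N/T⌋` are monotone. [folklore] -/
theorem monotone_blockEnd (M₀ N T : ℕ) : Monotone fun i : ℕ => M₀ + i * N / T :=
  fun _ _ hij => Nat.add_le_add_left (Nat.div_le_div_right (Nat.mul_le_mul_right N hij)) M₀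

/-- **The level block as `T` consecutive sub-blocks**: for `T ≥ 1`,
`Σ_{n ∈ (M₀, M₀+N]} f n = Σ_{i<T} Σ_{n ∈ (M₀ + ⌊iN/T⌋, M₀ + ⌊(i+1)N/T⌋]} f n`. [folklore] -/
theorem sum_Ioc_eq_sum_blocks {M : Type*} [AddCommMonoid M] (f : ℕ → M) (M₀ N : ℕ) {T : ℕ}
    (hT : 1 ≤ T) :
    ∑ n ∈ Ioc M₀ (M₀ + N), f n =
      ∑ i ∈ Finset.range T, ∑ n ∈ Ioc (M₀ + i * N / T) (M₀ + (i + 1) * N / T), f n := by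
  have h := sum_range_sum_Ioc_eq f (fun i => M₀ + i * N / T) (monotone_blockEnd M₀ N T) T
  simp only [zero_mul, Nat.zero_div, add_zero] at h
  rw [h, Nat.mul_div_cancel_left N (by omega)]

/-- Each sub-block has length `⌊(i+1)N/T⌋ − ⌊iN/T⌋ ≤ ⌊N/T⌋ + 1`. [folklore] -/
theorem block_length_le (N T i : ℕ) : (i + 1) * N / T - i * N / T ≤ N / T + 1 := by
  rcases Nat.eq_zero_or_pos T with rfl | hT
  · simp
  have h : (i + 1) * N / T ≤ i * N / T + N / T + 1 := by
    have h1 : (i + 1) * N = i * N + N := by ring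
    rw [h1, Nat.add_div hT]
    split_ifs <;> omega
  have hmono : i * N / T ≤ (i + 1) * N / T := Nat.div_le_div_right (Nat.mul_le_mul_right N (by omega))
  omega

/-- The sub-blocks sit inside the block: `M₀ ≤ M₀ + ⌊iN/T⌋` and `M₀ + ⌊(i+1)N/T⌋ ≤ M₀ + N` for `i < T`.
[folklore] -/
theorem blockEnd_le (M₀ N : ℕ) {T i : ℕ} (hi : i < T) : M₀ + (i + 1) * N / T ≤ M₀ + N := by
  have hT : 0 < T := by omega
  have h : (i + 1) * N / T ≤ N := by
    calc (i + 1) * N / T ≤ T * N / T := Nat.div_le_div_right (Nat.mul_le_mul_right N hi)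
      _ = N := Nat.mul_div_cancel_left N hT
  omega

end Summit.Parity.GeneralizedHardyLittlewood.Theorems.BeyondDiagonalBeatsQuarter.LevelSeparation

end
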